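import Literature.MathematicalPhysics.QuantumFieldTheory.Balaban1983to89.B5Eq165AxialMinV1
import Literature.MathematicalPhysics.QuantumFieldTheory.Balaban1983to89.B5HierAxialGaugeV1
import Literature.MathematicalPhysics.QuantumFieldTheory.BalabanImbrieJaffe1984to88.BIJ85LandauMinimizer442V1

/-!
# `Balaban1983to89.B5Eq165GaugeMinimaV1` — T. Bałaban, *Propagators and renormalization transformations for lattice gauge
theories. I*, Commun. Math. Phys. **95** (1984) 17–40 [Balaban1984PropagatorsI], (1.65) p. 29 PROPER on the V1 lattice calculus:
**`⟨B, Δ_kB⟩ = ⟨∂H_kB, ∂H_kB⟩`** — the quadratic form `Δ_k` DEFINED by the axial-gauge Gaussian (1.19) (`B5Eq119GaussianV1.DeltaK`) equals the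
action at the LANDAU-gauge minimizer `H_kB` of (1.47)/(1.58)–(1.64) (= [BalabanImbrieJaffe1985] (4.4.2), on V1 `BIJ85LandauMinimizer442V1`,
seat p11): the exchange of gauges (1.47) at the level of the Gaussian exponents, i.e. THE AXIAL AND THE LANDAU MINIMA OF `½‖∂A‖²` OVER
`{Q_kA = B}` COINCIDE (both are the unconstrained-gauge infimum, by gauge invariance of the action and completeness of either gauge)

statement-level skeleton of published theorems with citation tags; proofs where landed; nothing here is a claim about the Yang–Mills mass gap

PDF held: `paper:balaban1984-cmp95-propagators-rt-i` (journal page = PDF page + 16), pp. 26, 29 [PDF 10, 13], text layer.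

PRINT, verbatim.  p. 26 (before (1.47)): "a configuration `A` on `T_η` minimizing the form `½⟨∂A, ∂A⟩` under the conditions `Q_kA = B`,
`R∂*A = 0`".  p. 29: "`H_kB` is a minimum of `½⟨∂A, ∂A⟩` on the hyperplane `{A : Q_kA = B, R∂*A = 0}` … Let us now come back to the integral
(1.47). We make the translation `A = A′ + H_kB` and using the above properties of `H_kB`, we get `(1.47) = Z_k exp(−½⟨∂H_kB, ∂H_kB⟩)`. (1.64)
The action `Δ_k` is thus defined by `⟨B, Δ_kB⟩ = ⟨∂H_kB, ∂H_kB⟩`. (1.65)".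

CITATION HEADER (lean-in-tree rule) — WHAT IS REPRODUCED.  Phase-2 proof file of the lit-balaban typed skeleton (HOME
`run/shared/lean/pub/lit-balaban/`), seat p38 (gen 2), a KNITTING file for rows `B5.Eq1.64`/`B5.Eq1.66` ((1.64)/(1.65), fold owner r02;
torus decls of record `B5Eq165DeltaK.eq164`/`eq165`, seat p16; torus bridge «Δ_k^{(1.19)} = Δ_k^{(1.65)}» = interface IF2-25) and `B5.Eq1.47`
(exchange of gauges; torus `B5Eq147Landau`, seat p16), ON V1: the (1.19) form `B5Eq119GaussianV1.DeltaK`/`B5Eq165AxialMinV1` (this seat,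
axial minimum `½⟨B, Δ_kB⟩ = min_{(1.17) fibre} S`), the hierarchical axial gauge completeness `B5HierAxialGaugeV1.hierAxial_exists` (seat p33:
every field is carried into the axial fibre by a `λ ∈ N(Q′_k)`), and the V1 Landau minimizer `BIJ85LandauMinimizer442.Hk (opsV1 P k c s)`
with its p. 313 minimality `BIJ85LandauMinimizer442V1.Hk_isLandauMinimizer_V1`, gauge structure `gaugeStructure_V1` and the projection
`LandauOps.projR` (seat p11) — all BY NAME, nothing re-declared, no new definitions.
WHAT IS PROVED (kernel; standard axioms; `k ≤ m + K`, `c ≠ 0`; action `S = ½Σ_p w|(∂A)(p)|²` = `curlAction w c`, `w > 0`, and p11's weighted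
`∂ = s·curl c` with `w = s²`, `s ≠ 0`): **the unconstrained-gauge minimum** `isLeast_curlAction_avgFibre`: `½⟨B, Δ_kB⟩ = min{S(A) : Q_kA = B}`
(gauge invariance + `hierAxial_exists`); **Landau reachability** `exists_landau_gauge`: every `A` has a `λ ∈ N(Q′_k)` with `R∂*(A − ∂λ) = 0`
(`R∂*A ∈ ΔN(Q′_k)`); **(1.65)** `eq165_landau`: `½‖∂H_kB‖² = ½⟨B, Δ_kB⟩`, i.e. `⟨B, Δ_kB⟩ = ⟨∂H_kB, ∂H_kB⟩` (`inner_DeltaK_eq_norm_curl_Hk_sq`);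
the Landau minimum `isLeast_landau` and **the equality of the axial and Landau minima** `min_axial_eq_min_landau`; **(1.64)** `eq164_landau`:
`((ST)^k e^{−S})(B) = Z_{k,Ax}·exp(−½‖∂H_kB‖²)`.

Unit `lit-balaban-p38` (literature-prover-lit-balaban-p38-g2-0), 2026-08-21.
-/

open scoped BigOperators RealInnerProductSpace

namespace Literature.MathematicalPhysics.QuantumFieldTheory.Balaban1983to89

namespace B5Eq165GaugeMinimaV1

open LatticeFieldCalculus MeasureTheory Matrix B5Eq112RenormTransf B5Eq117CompositionV1 B5Eq119GaussianV1 B5Eq165AxialMinV1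
open B5Eq120IterProof (bondAvgIter_gaugeShift)
open B5HierAxialGaugeV1 (hierAxial_exists)
open Literature.MathematicalPhysics.QuantumFieldTheory.BalabanImbrieJaffe1984to88.BIJ85AxialPropagator411 (constraint411 mem_constraint411)
open Literature.MathematicalPhysics.QuantumFieldTheory.BalabanImbrieJaffe1984to88.BIJ85LandauForm441
open Literature.MathematicalPhysics.QuantumFieldTheory.BalabanImbrieJaffe1984to88.BIJ85LandauMinimizer442 (Hk)
open Literature.MathematicalPhysics.QuantumFieldTheory.BalabanImbrieJaffe1984to88.BIJ85LandauMinimizer442V1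

noncomputable section

variable {P : Params} {k : ℕ}

/-! ## 1. The unconstrained-gauge minimum: `½⟨B, Δ_kB⟩ = min{S(A) : Q_kA = B}` -/

/-- `A − ∂0 = A`. [folklore] -/
private theorem gaugeShift_zero' {j : ℕ} (c : ℝ) (A : VecField P j ℝ) : gaugeShift c (0 : SiteField P j ℝ) A = A := by
  have h : grad c (0 : SiteField P j ℝ) = 0 := by funext b; simp [grad]
  funext b
  simp [gaugeShift, h]

/-- EVERY FIELD WITH `Q_kA = B` IS GAUGE EQUIVALENT TO A POINT OF THE FIBRE of (1.17) over the same `B`: by the completeness of the hierarchical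
axial gauge (`B5HierAxialGaugeV1.hierAxial_exists`: a `λ` with `Q′_kλ = 0` making all `Q_jA^λ`, `j < k`, axial), and (1.20)
`Q_kA^λ = Q_kA − ∂Q′_kλ = Q_kA`. [cite: Balaban1984PropagatorsI, (1.23) p.21] -/
theorem exists_gaugeShift_mem_fibreIter (hk : k ≤ P.m + P.K) {c : ℝ} (hc : c ≠ 0) {B : VecField P k ℝ} {A : VecField P 0 ℝ}
    (hA : bondAvgIter k A = B) : ∃ lam : SiteField P 0 ℝ, gaugeShift c lam A ∈ fibreIter k B := by
  obtain ⟨lam, htop, hax⟩ := hierAxial_exists hk hc A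
  refine ⟨lam, (mem_fibreIter k B _).2 ⟨fun j hj => hax j hj, ?_⟩⟩
  rw [bondAvgIter_gaugeShift k hk, htop, hA, gaugeShift_zero']

/-- **`½⟨B, Δ_kB⟩` IS THE MINIMUM OF THE ACTION OVER ALL OF `{A : Q_kA = B}`** (no gauge condition): the action is gauge invariant and every
such `A` is gauge equivalent to a point of the axial fibre, where the minimum is `½⟨B, Δ_kB⟩` (`B5Eq165AxialMinV1.isLeast_curlAction_fibreIter`).
[cite: Balaban1984PropagatorsI, (1.65) p.29] -/
theorem isLeast_curlAction_avgFibre (hk : k ≤ P.m + P.K) {w : ℝ} (hw : 0 < w) {c : ℝ} (hc : c ≠ 0) (B : VecField P k ℝ) :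
    IsLeast ((curlAction w c) '' {A : VecField P 0 ℝ | bondAvgIter k A = B}) ((1 / 2) * (B ⬝ᵥ (DeltaK P k w c *ᵥ B))) := by
  refine ⟨⟨axMin P k w c B, ((mem_fibreIter k B _).1 (axMin_mem_fibreIter hk B)).2, curlAction_axMin hk hw hc B⟩, ?_⟩
  rintro _ ⟨A, hA, rfl⟩
  obtain ⟨lam, hmem⟩ := exists_gaugeShift_mem_fibreIter hk hc (B := B) hA
  rw [← curlAction_gaugeShift w c c lam A]
  exact curlAction_ge_of_mem_fibreIter hk hw hmem

/-! ## 2. The Landau gauge is reachable inside `{Q_kA = B}` -/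

section Landau

variable {c s : ℝ}

/-- `½‖∂A‖²` for p11's weighted `∂ = s·curl c` IS the action `curlAction (s²) c`. [cite: BalabanImbrieJaffe1985, (4.4.2) p.312] -/
theorem half_norm_curl_sq (k : ℕ) (c s : ℝ) (A : EuclideanSpace ℝ (PBond P 0)) :
    (1 / 2 : ℝ) * ‖(opsV1 P k c s).curl A‖ ^ 2 = curlAction (s ^ 2) c (WithLp.ofLp A) := by
  rw [opsV1_curl, norm_smul, mul_pow, Real.norm_eq_abs, sq_abs, EuclideanSpace.norm_sq_eq, curlAction, Finset.mul_sum]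

/-- **LANDAU REACHABILITY**: every field `A` has a gauge function `λ ∈ N(Q′_k)` with `R∂*(A − ∂λ) = 0` — because `R∂*A ∈ ΔN(Q′_k)` (the range
of the projection `R`, [6I] p. 25) and `∂*∂λ = Δλ`. [cite: Balaban1984PropagatorsI, (1.47) p.26] -/
theorem exists_landau_gauge (hk : k ≤ P.m + P.K) (c s : ℝ) (A : EuclideanSpace ℝ (PBond P 0)) :
    ∃ l : EuclideanSpace ℝ (Site P 0), (opsV1 P k c s).Qp l = 0 ∧
      (opsV1 P k c s).projR ((opsV1 P k c s).dstar (A - gradV1 P c l)) = 0 := by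
  have hmem : (opsV1 P k c s).projR ((opsV1 P k c s).dstar A) ∈ (opsV1 P k c s).gaugeRange := by
    unfold LandauOps.projR
    exact Submodule.starProjection_apply_mem _ _
  obtain ⟨l, hl, hlap⟩ := Submodule.mem_map.1 hmem
  have hl' : (opsV1 P k c s).Qp l = 0 := (LandauOps.mem_kerQp _).1 hl
  refine ⟨l, hl', ?_⟩
  rw [map_sub, (gaugeStructure_V1 hk c s).dstar_grad, map_sub, (opsV1 P k c s).projR_lap_of_mem hl', hlap, sub_self]

/-- A gauge transformation by `λ ∈ N(Q′_k)` keeps `Q_kA` and `½‖∂A‖²`. [cite: Balaban1984PropagatorsI, (1.47) p.26] -/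
theorem landau_gauge_invariants (hk : k ≤ P.m + P.K) (c s : ℝ) (A : EuclideanSpace ℝ (PBond P 0)) {l : EuclideanSpace ℝ (Site P 0)}
    (hl : (opsV1 P k c s).Qp l = 0) :
    (opsV1 P k c s).Qk (A - gradV1 P c l) = (opsV1 P k c s).Qk A ∧
      ‖(opsV1 P k c s).curl (A - gradV1 P c l)‖ = ‖(opsV1 P k c s).curl A‖ := by
  constructor
  · rw [map_sub, (gaugeStructure_V1 hk c s).Qk_grad l hl, sub_zero]
  · rw [map_sub, (gaugeStructure_V1 hk c s).curl_grad, sub_zero]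

/-- **(1.65) PROPER**: `½‖∂H_kB‖² = ½⟨B, Δ_kB⟩` — the action at the LANDAU-gauge minimizer `H_kB` (p11's `Hk (opsV1 P k c s)`, weighted
`∂ = s·curl c`) equals half the AXIAL-gauge form of (1.19) (`DeltaK P k (s²) c`), for every `B` (`k ≤ m + K`, `c ≠ 0`, `s ≠ 0`).
[cite: Balaban1984PropagatorsI, (1.65) p.29] -/
theorem eq165_landau (hk : k ≤ P.m + P.K) (hc : c ≠ 0) (hs : s ≠ 0) (B : VecField P k ℝ) :
    (1 / 2 : ℝ) * ‖(opsV1 P k c s).curl (Hk (opsV1 P k c s) B)‖ ^ 2 = (1 / 2) * (B ⬝ᵥ (DeltaK P k (s ^ 2) c *ᵥ B)) := by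
  have hw : 0 < s ^ 2 := by positivity
  obtain ⟨hQ, -, hmin⟩ := Hk_isLandauMinimizer_V1 hk hc hs B
  apply le_antisymm
  · -- a Landau-gauge point with the axial minimal value: gauge-transform the least-squares point
    obtain ⟨l, hl, hR⟩ := exists_landau_gauge hk c s (WithLp.toLp 2 (axMin P k (s ^ 2) c B))
    obtain ⟨hQ₂, hn₂⟩ := landau_gauge_invariants hk c s (WithLp.toLp 2 (axMin P k (s ^ 2) c B)) hl
    have hQ₁ : (opsV1 P k c s).Qk (WithLp.toLp 2 (axMin P k (s ^ 2) c B)) = B := by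
      rw [opsV1_Qk, WithLp.ofLp_toLp]
      exact ((mem_fibreIter k B _).1 (axMin_mem_fibreIter hk B)).2
    have h := hmin _ (hQ₂.trans hQ₁) hR
    rw [hn₂, half_norm_curl_sq k c s (WithLp.toLp 2 (axMin P k (s ^ 2) c B)), WithLp.ofLp_toLp, curlAction_axMin hk hw hc] at h
    exact h
  · -- `H_kB` has `Q_kH_kB = B`, so its action is at least the unconstrained-gauge minimum
    have hQ' : bondAvgIter k (WithLp.ofLp (Hk (opsV1 P k c s) B)) = B := by rw [← opsV1_Qk k c s]; exact hQ
    rw [half_norm_curl_sq]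
    exact (isLeast_curlAction_avgFibre hk hw hc B).2 ⟨_, hQ', rfl⟩

/-- **(1.65) as printed**: `⟨B, Δ_kB⟩ = ⟨∂H_kB, ∂H_kB⟩`. [cite: Balaban1984PropagatorsI, (1.65) p.29] -/
theorem inner_DeltaK_eq_norm_curl_Hk_sq (hk : k ≤ P.m + P.K) (hc : c ≠ 0) (hs : s ≠ 0) (B : VecField P k ℝ) :
    B ⬝ᵥ (DeltaK P k (s ^ 2) c *ᵥ B) =
      ⟪(opsV1 P k c s).curl (Hk (opsV1 P k c s) B), (opsV1 P k c s).curl (Hk (opsV1 P k c s) B)⟫ := by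
  rw [real_inner_self_eq_norm_sq]
  have h := eq165_landau hk hc hs B
  linarith

/-- **The Landau-gauge minimum** (p. 29: "`H_kB` is a minimum of `½⟨∂A, ∂A⟩` on the hyperplane `{A : Q_kA = B, R∂*A = 0}`") IS `½⟨B, Δ_kB⟩`.
[cite: Balaban1984PropagatorsI, (1.64) p.29] -/
theorem isLeast_landau (hk : k ≤ P.m + P.K) (hc : c ≠ 0) (hs : s ≠ 0) (B : VecField P k ℝ) :
    IsLeast ((fun A => (1 / 2 : ℝ) * ‖(opsV1 P k c s).curl A‖ ^ 2) ''
        {A | (opsV1 P k c s).Qk A = B ∧ (opsV1 P k c s).projR ((opsV1 P k c s).dstar A) = 0})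
      ((1 / 2) * (B ⬝ᵥ (DeltaK P k (s ^ 2) c *ᵥ B))) := by
  obtain ⟨hQ, hR, hmin⟩ := Hk_isLandauMinimizer_V1 hk hc hs B
  refine ⟨⟨Hk (opsV1 P k c s) B, ⟨hQ, hR⟩, eq165_landau hk hc hs B⟩, ?_⟩
  rintro _ ⟨A, ⟨hA, hAR⟩, rfl⟩
  rw [← eq165_landau hk hc hs B]
  exact hmin A hA hAR

/-- **THE AXIAL AND THE LANDAU MINIMA COINCIDE** (the content of the exchange of gauges (1.47) for the Gaussian exponents): the least action
over the fibre `{Q_kA = B, δ_Ax(Q_{k−1}A)⋯δ_Ax(A)}` of (1.17) equals the least `½‖∂A‖²` over the hyperplane `{Q_kA = B, R∂*A = 0}` of (1.47).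
[cite: Balaban1984PropagatorsI, (1.47) p.26] -/
theorem min_axial_eq_min_landau (hk : k ≤ P.m + P.K) (hc : c ≠ 0) (hs : s ≠ 0) (B : VecField P k ℝ) :
    ∃ m : ℝ, IsLeast ((curlAction (s ^ 2) c) '' fibreIter k B) m ∧
      IsLeast ((fun A => (1 / 2 : ℝ) * ‖(opsV1 P k c s).curl A‖ ^ 2) ''
        {A | (opsV1 P k c s).Qk A = B ∧ (opsV1 P k c s).projR ((opsV1 P k c s).dstar A) = 0}) m :=
  ⟨_, isLeast_curlAction_fibreIter hk (by positivity) hc B, isLeast_landau hk hc hs B⟩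

/-- **(1.64)** p. 29, for the V1 transformation of record: `((ST)^k e^{−S})(B) = Z_{k,Ax}·exp(−½‖∂H_kB‖²)` with the LANDAU minimizer `H_kB`
(print: "(1.47) = Z_k exp(−½⟨∂H_kB, ∂H_kB⟩) (1.64)"; the constants `Z_k`/`Z_{k,Ax}` differ by the exchange of gauges (1.47), not evaluated).
[cite: Balaban1984PropagatorsI, (1.64) p.29] -/
theorem eq164_landau (hk : k ≤ P.m + P.K) (hc : c ≠ 0) (hs : s ≠ 0) (B : VecField P k ℝ) :
    rtPow k (fun A => Real.exp (-curlAction (s ^ 2) c A)) B =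
      zAx P k (s ^ 2) c * Real.exp (-((1 / 2 : ℝ) * ‖(opsV1 P k c s).curl (Hk (opsV1 P k c s) B)‖ ^ 2)) := by
  rw [eq119 hk (by positivity) hc, eq165_landau hk hc hs, neg_mul]

end Landau

end

end B5Eq165GaugeMinimaV1

end Literature.MathematicalPhysics.QuantumFieldTheory.Balaban1983to89
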